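import Mathlib
import Literature.Analysis.FluidPDE.OseenSliceFarField
import Literature.Analysis.FluidPDE.KNSSRemark61
import Summits.NavierStokesRegularity.NavierStokesRegularity.Theorems.LevelSetModerationHighSpeedPressureWorkFastSetGradientBricks

/-!
# Route LevelSetModeration — `HighSpeedPressureWork`: localised source bound for the Oseen slice at a near-extremal point

Support file for item stmt-NavierStokesRegularity-18149 (`HighSpeedPressureWork`), stub
`stub_earlyBookkeeping` (margin zero), on the way to the LOG-FREE fast-set speed-gradient
bound (sharpening `levelSetModeration_fastSetGradient`, whose caloric deficit estimate
`δ ≲ √t` costs a `√log(1/t)` through Hamilton's estimate). The improvement comes from a better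
bound of the Duhamel term AT the fast point: its sources `P∇·(u ⊗ u − c ⊗ c)`, `c = B e`, are
small wherever the caloric deficit `f = B − e·e^{θΔ}u(s₀)` is small, and the sharp Harnack
inequality (`heatExtension_le_harnack_shift`, p167770) makes `f` small on a whole ball around
the fast point at every earlier time; outside that ball the far-field bound of the Oseen slice
(`exists_norm_oseenSlice_le_of_far`, uniform in the kernel time) takes over.

This file proves the resulting ONE-SLICE estimate, `levelSetModeration_oseenSlice_source_le`,
in abstract form: for a field `v = e^{θΔ}a − W` with `‖a‖ ≤ B_s ≤ 1`, `‖v‖ ≤ 1`, `‖W‖ ≤ ω`, a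
unit vector `e`, a radius `r` and a level `Λ` with `e^{θΔ}(B_s − e·a) ≤ Λ` on the ball `B(x, r)`:

  `‖N_τ[v, v](x)‖ ≤ 2 C_S τ^{-1/2} (√(2 B_s Λ) + ω) + 4 C_F / r`

(decomposition `v = V + B_s e`, `N[c,c] = 0` by `integral_oseenKernel_sub_left_eq_zero`,
`‖e^{θΔ}a − B_s e‖² ≤ 2B_s (B_s − e·e^{θΔ}a)`, truncation of `V` at the ball, the sup bound
`exists_norm_oseenSlice_le` inside and the far-field bound outside).
-/

noncomputable section

-- single-conjunct summit: `Summit.<Summit>.<Problem>` repeats the name by the D-0017 layout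
set_option linter.dupNamespace false

namespace Summit.NavierStokesRegularity.NavierStokesRegularity.Theorems

open MeasureTheory Set Filter Topology Function Metric
open scoped ENNReal RealInnerProductSpace
open Literature.Analysis.FluidPDE
open Literature.Analysis.UnboundedOperators (heatExtension norm_heatExtension_le_of_bound
  contDiff_heatExtension_holds memLp_top_of_continuous_of_bound)

/-- **Deviation of a sub-extremal vector from the extremal direction**: if `‖h‖ ≤ B` and
`‖e‖ = 1` then `‖h − B e‖² ≤ 2 B (B − ⟪e, h⟫)`. [folklore] -/
theorem fastSet_norm_sub_smul_sq_le {F : Type*} [NormedAddCommGroup F] [InnerProductSpace ℝ F]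
    {h e : F} {B : ℝ} (hh : ‖h‖ ≤ B) (he : ‖e‖ = 1) :
    ‖h - B • e‖ ^ 2 ≤ 2 * B * (B - ⟪e, h⟫) := by
  have hB : 0 ≤ B := (norm_nonneg _).trans hh
  have h1 : ‖h - B • e‖ ^ 2 = ‖h‖ ^ 2 - 2 * B * ⟪e, h⟫ + B ^ 2 := by
    rw [@norm_sub_sq ℝ, norm_smul, Real.norm_of_nonneg hB, he, mul_one, real_inner_smul_right,
      real_inner_comm]
    simp only [RCLike.re_to_real]
    ring
  rw [h1]
  nlinarith [pow_le_pow_left₀ (norm_nonneg h) hh 2]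

/-- **One-slice source bound at a near-extremal point.** There are constants `C_S, C_F > 0`
(the sup and far-field constants of the Oseen slice on `ℝ³`) such that: for a kernel time
`τ > 0`, a caloric time `θ > 0`, a continuous datum `a` with `‖a‖ ≤ B_s`, `0 < B_s ≤ 1`, a unit
vector `e`, a continuous field `v` with `‖v‖ ≤ 1` of the form `v = e^{θΔ}a − W` with `‖W‖ ≤ ω`,
a point `x`, a radius `r > 0` and a level `Λ ≥ 0` with `e^{θΔ}(B_s − ⟪e, a⟫)(y) ≤ Λ` whenever
`‖x − y‖ < r`:

  `‖N_τ[v, v](x)‖ ≤ 2 C_S τ^{-1/2} (√(2 B_s Λ) + ω) + 4 C_F / r`.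

[folklore] -/
theorem levelSetModeration_oseenSlice_source_le :
    ∃ CS CF : ℝ, 0 < CS ∧ 0 < CF ∧ ∀ {τ θ Bs ω Λ r : ℝ} {a v W : EuclideanSpace ℝ (Fin 3) → EuclideanSpace ℝ (Fin 3)} {e x : EuclideanSpace ℝ (Fin 3)}, 0 < τ → 0 < θ → 0 < Bs → Bs ≤ 1 → 0 ≤ ω → 0 ≤ Λ → 0 < r → Continuous a → (∀ y, ‖a y‖ ≤ Bs) → ‖e‖ = 1 → Continuous v → (∀ y, ‖v y‖ ≤ 1) → (∀ y, v y = Literature.Analysis.UnboundedOperators.heatExtension a θ y - W y) → (∀ y, ‖W y‖ ≤ ω) → (∀ y, ‖x - y‖ < r → Literature.Analysis.UnboundedOperators.heatExtension (fun z => Bs - inner ℝ e (a z)) θ y ≤ Λ) → ‖Literature.Analysis.FluidPDE.oseenSlice τ v v x‖ ≤ 2 * CS * τ ^ (-(1 / 2 : ℝ)) * (Real.sqrt (2 * Bs * Λ) + ω) + 4 * CF / r := by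
  obtain ⟨CS, hCS, hS⟩ := exists_norm_oseenSlice_le (E := EuclideanSpace ℝ (Fin 3))
  obtain ⟨CF, hCF, hFl⟩ := exists_norm_oseenSlice_le_of_far_left (E := EuclideanSpace ℝ (Fin 3))
  obtain ⟨CF', hCF', hFr⟩ := exists_norm_oseenSlice_le_of_far_right (E := EuclideanSpace ℝ (Fin 3))
  refine ⟨CS, max CF CF', hCS, lt_max_of_lt_left hCF, ?_⟩
  intro τ θ Bs ω Λ r a v W e x hτ hθ hBs hBs1 hω hΛ hr ha haB he hv hv1 hvW hW hΛr
  -- the caloric part and the deficit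
  set H : EuclideanSpace ℝ (Fin 3) → EuclideanSpace ℝ (Fin 3) := heatExtension a θ with hHdef
  have hHB : ∀ y, ‖H y‖ ≤ Bs := fun y => norm_heatExtension_le_of_bound haB hθ y
  have hf : ∀ y, heatExtension (fun z => Bs - ⟪e, a z⟫) θ y = Bs - ⟪e, H y⟫ := fun y =>
    heatExtension_const_sub_inner ha haB Bs e hθ y
  -- the recentred field `V = v - Bs e` and its size
  set c₀ : EuclideanSpace ℝ (Fin 3) := Bs • e with hc₀
  set V : EuclideanSpace ℝ (Fin 3) → EuclideanSpace ℝ (Fin 3) := fun y => v y - c₀ with hVdef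
  have hVc : Continuous V := hv.sub continuous_const
  have hV2 : ∀ y, ‖V y‖ ≤ 2 := fun y => by
    calc ‖V y‖ ≤ ‖v y‖ + ‖c₀‖ := norm_sub_le _ _
      _ ≤ 1 + 1 := by
          refine add_le_add (hv1 y) ?_
          rw [hc₀, norm_smul, Real.norm_of_nonneg hBs.le, he, mul_one]; exact hBs1
      _ = 2 := by norm_num
  have hVf : ∀ y, ‖V y‖ ≤ Real.sqrt (2 * Bs * (Bs - ⟪e, H y⟫)) + ω := by
    intro y
    have h1 : V y = (H y - c₀) - W y := by
      simp only [hVdef, hvW y, hHdef]; abel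
    have h2 : ‖H y - c₀‖ ≤ Real.sqrt (2 * Bs * (Bs - ⟪e, H y⟫)) := by
      rw [← Real.sqrt_sq (norm_nonneg _)]
      exact Real.sqrt_le_sqrt (by rw [hc₀]; exact fastSet_norm_sub_smul_sq_le (hHB y) he)
    rw [h1]
    exact (norm_sub_le _ _).trans (add_le_add h2 (hW y))
  -- the uniform bound inside the ball
  set m : ℝ := Real.sqrt (2 * Bs * Λ) + ω with hm
  have hm0 : 0 ≤ m := by rw [hm]; positivity
  have hVin : ∀ y, ‖x - y‖ < r → ‖V y‖ ≤ m := by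
    intro y hy
    refine (hVf y).trans (add_le_add ?_ le_rfl)
    refine Real.sqrt_le_sqrt (mul_le_mul_of_nonneg_left ?_ (by positivity))
    rw [← hf y]
    exact hΛr y hy
  -- truncation at the ball
  set Sball : Set (EuclideanSpace ℝ (Fin 3)) := {y | ‖x - y‖ < r} with hSball
  have hSmeas : MeasurableSet Sball := by
    have : Sball = Metric.ball x r := by
      ext y; simp only [hSball, mem_setOf_eq, Metric.mem_ball, dist_eq_norm, norm_sub_rev]
    rw [this]; exact measurableSet_ball
  set Vin : EuclideanSpace ℝ (Fin 3) → EuclideanSpace ℝ (Fin 3) := Sball.indicator V with hVin_def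
  set Vout : EuclideanSpace ℝ (Fin 3) → EuclideanSpace ℝ (Fin 3) := Sballᶜ.indicator V with hVout_def
  have hVsplit : V = Vin + Vout := by rw [hVin_def, hVout_def, Set.indicator_self_add_compl]
  have hVin_m : ∀ y, ‖Vin y‖ ≤ m := by
    intro y
    by_cases hy : y ∈ Sball
    · rw [hVin_def, indicator_of_mem hy]; exact hVin y hy
    · rw [hVin_def, indicator_of_notMem hy, norm_zero]; exact hm0
  have hVout_2 : ∀ y, ‖Vout y‖ ≤ 2 := fun y =>
    (norm_indicator_le_norm_self _ _).trans (hV2 y)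
  have hVout_zero : ∀ y, ‖x - y‖ < r → Vout y = 0 := fun y hy => by
    have hmem : y ∈ Sball := hy
    rw [hVout_def, indicator_of_notMem (fun h : y ∈ Sballᶜ => h hmem)]
  -- measurability of the pieces
  have hVm : AEStronglyMeasurable V volume := hVc.aestronglyMeasurable
  have hVin_meas : AEStronglyMeasurable Vin volume :=
    (hVc.measurable.indicator hSmeas).aestronglyMeasurable
  have hVout_meas : AEStronglyMeasurable Vout volume :=
    (hVc.measurable.indicator hSmeas.compl).aestronglyMeasurable
  have hvm : AEStronglyMeasurable v volume := hv.aestronglyMeasurable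
  have hcm : AEStronglyMeasurable (fun _ : EuclideanSpace ℝ (Fin 3) => c₀) volume :=
    aestronglyMeasurable_const
  have hc₀n : ∀ y : EuclideanSpace ℝ (Fin 3), ‖(fun _ => c₀) y‖ ≤ Bs := fun y => by
    show ‖c₀‖ ≤ Bs
    rw [hc₀, norm_smul, Real.norm_of_nonneg hBs.le, he, mul_one]
  -- integrability of all slice integrands (bounded measurable fields, `τ > 0`)
  have iVv := integrable_oseenKernel_slice_of_bound hτ hVm hvm hV2 hv1 x
  have icv := integrable_oseenKernel_slice_of_bound hτ hcm hvm hc₀n hv1 x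
  have iVin_v := integrable_oseenKernel_slice_of_bound hτ hVin_meas hvm hVin_m hv1 x
  have iVout_v := integrable_oseenKernel_slice_of_bound hτ hVout_meas hvm hVout_2 hv1 x
  have icV := integrable_oseenKernel_slice_of_bound hτ hcm hVm hc₀n hV2 x
  have icc := integrable_oseenKernel_slice_of_bound hτ hcm hcm hc₀n hc₀n x
  have icVin := integrable_oseenKernel_slice_of_bound hτ hcm hVin_meas hc₀n hVin_m x
  have icVout := integrable_oseenKernel_slice_of_bound hτ hcm hVout_meas hc₀n hVout_2 x
  -- the decomposition `N[v,v] = N[Vin,v] + N[Vout,v] + N[c₀,Vin] + N[c₀,Vout]` (`N[c₀,c₀] = 0`)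
  have hv_eq : v = V + fun _ => c₀ := by funext y; simp [hVdef]
  have hcc : oseenSlice τ (fun _ => c₀) (fun _ => c₀) x = 0 := by
    rw [oseenSlice_apply]
    exact integral_oseenKernel_sub_left_eq_zero τ x c₀ c₀
  have hdec : oseenSlice τ v v x = oseenSlice τ Vin v x + oseenSlice τ Vout v x +
      (oseenSlice τ (fun _ => c₀) Vin x + oseenSlice τ (fun _ => c₀) Vout x) := by
    have h1 : oseenSlice τ v v x = oseenSlice τ V v x + oseenSlice τ (fun _ => c₀) v x := by
      conv_lhs => rw [show oseenSlice τ v v x = oseenSlice τ (V + fun _ => c₀) v x by rw [← hv_eq]]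
      exact oseenSlice_add_left iVv icv
    have h2 : oseenSlice τ (fun _ => c₀) v x =
        oseenSlice τ (fun _ => c₀) V x + oseenSlice τ (fun _ => c₀) (fun _ => c₀) x := by
      conv_lhs => rw [show oseenSlice τ (fun _ => c₀) v x =
        oseenSlice τ (fun _ => c₀) (V + fun _ => c₀) x by rw [← hv_eq]]
      exact oseenSlice_add_right icV icc
    have h3 : oseenSlice τ V v x = oseenSlice τ Vin v x + oseenSlice τ Vout v x := by
      conv_lhs => rw [hVsplit]
      exact oseenSlice_add_left iVin_v iVout_v
    have h4 : oseenSlice τ (fun _ => c₀) V x =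
        oseenSlice τ (fun _ => c₀) Vin x + oseenSlice τ (fun _ => c₀) Vout x := by
      conv_lhs => rw [hVsplit]
      exact oseenSlice_add_right icVin icVout
    rw [h1, h2, hcc, add_zero, h3, h4]
  -- the four bounds
  have b1 : ‖oseenSlice τ Vin v x‖ ≤ CS * τ ^ (-(1 / 2 : ℝ)) * m * 1 := hS hτ hVin_m hv1 x
  have b2 : ‖oseenSlice τ Vout v x‖ ≤ CF * 2 * 1 / r := hFl hτ hVout_2 hv1 hr hVout_zero
  have b3 : ‖oseenSlice τ (fun _ => c₀) Vin x‖ ≤ CS * τ ^ (-(1 / 2 : ℝ)) * Bs * m :=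
    hS hτ hc₀n hVin_m x
  have b4 : ‖oseenSlice τ (fun _ => c₀) Vout x‖ ≤ CF' * Bs * 2 / r := hFr hτ hc₀n hVout_2 hr hVout_zero
  have hτ' : 0 < τ ^ (-(1 / 2 : ℝ)) := Real.rpow_pos_of_pos hτ _
  have b3' : CS * τ ^ (-(1 / 2 : ℝ)) * Bs * m ≤ CS * τ ^ (-(1 / 2 : ℝ)) * m := by
    have : CS * τ ^ (-(1 / 2 : ℝ)) * Bs * m = Bs * (CS * τ ^ (-(1 / 2 : ℝ)) * m) := by ring
    rw [this]
    exact mul_le_of_le_one_left (by positivity) hBs1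
  have b2' : CF * 2 * 1 / r ≤ 2 * max CF CF' / r := by
    rw [mul_one, mul_comm]
    exact div_le_div_of_nonneg_right (mul_le_mul_of_nonneg_left (le_max_left _ _) (by norm_num))
      hr.le
  have b4' : CF' * Bs * 2 / r ≤ 2 * max CF CF' / r := by
    refine div_le_div_of_nonneg_right ?_ hr.le
    calc CF' * Bs * 2 ≤ CF' * 1 * 2 := by gcongr
      _ ≤ max CF CF' * 1 * 2 := by gcongr; exact le_max_right _ _
      _ = 2 * max CF CF' := by ring
  rw [hdec]
  calc ‖oseenSlice τ Vin v x + oseenSlice τ Vout v x +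
        (oseenSlice τ (fun _ => c₀) Vin x + oseenSlice τ (fun _ => c₀) Vout x)‖
      ≤ (‖oseenSlice τ Vin v x‖ + ‖oseenSlice τ Vout v x‖) +
          (‖oseenSlice τ (fun _ => c₀) Vin x‖ + ‖oseenSlice τ (fun _ => c₀) Vout x‖) :=
        (norm_add_le _ _).trans (add_le_add (norm_add_le _ _) (norm_add_le _ _))
    _ ≤ (CS * τ ^ (-(1 / 2 : ℝ)) * m * 1 + 2 * max CF CF' / r) +
          (CS * τ ^ (-(1 / 2 : ℝ)) * m + 2 * max CF CF' / r) :=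
        add_le_add (add_le_add b1 (b2.trans b2')) (add_le_add (b3.trans b3') (b4.trans b4'))
    _ = 2 * CS * τ ^ (-(1 / 2 : ℝ)) * (Real.sqrt (2 * Bs * Λ) + ω) + 4 * max CF CF' / r := by
        rw [hm]; ring

end Summit.NavierStokesRegularity.NavierStokesRegularity.Theorems

end
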